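import Mathlib

/-!
# SoloBlind — isospectral planes through a regular semisimple point of `gl₃` (anchor of LieExponent §3.32, Lemma 18.4)

Pen side (`paper/LieExponent.md` §3.32, Remark 18.3 and Lemma 18.4): for `p₀ = diag(p₁,p₂,p₃)` with distinct
entries and an off-diagonal `e`, the pencil `p₀ + s e` is isospectral iff
(1) `π₁₂ + π₁₃ + π₂₃ = 0`, (2) `p₃π₁₂ + p₂π₁₃ + p₁π₂₃ = 0`, (3) `γ + γ' = 0`
(`π_ij = e_ij e_ji`, `γ = e₁₂e₂₃e₃₁`, `γ' = e₁₃e₃₂e₂₁`), and the solutions are the `𝔫_w`-planes (acyclic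
support) and the rank-one one-parameter planes `e = [u vᵀ, p₀]`, `vᵀu = vᵀp₀u = 0`.  Checked here:

* `soloLie_gl3_det_pencil` — the determinant of the pencil (source of (2) and (3));
* `soloLie_gl3_minors_pencil` — the sum of principal `2 × 2` minors (source of (1));
* `soloLie_gl3_rankOne_bracket` — `[u vᵀ, diag p]_ij = u_i v_j (p_j − p_i)`;
* `soloLie_gl3_rankOne_conditions` — for `e = [u vᵀ, diag p]`: (3) holds identically, and the left side of
  (1) equals `A C − B²` with `A = Σ w_i`, `B = Σ p_i w_i`, `C = Σ p_i² w_i`, `w_i = u_i v_i`;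
* `soloLie_gl3_wstar` — `w* = (p₂−p₃, p₃−p₁, p₁−p₂)` has `A = B = 0` and solves (1) and (2) (the polynomial
  identity that was only grid-checked on the pen side);
* `soloLie_rankOne_completion3` — a `3 × 3` array with non-zero off-diagonal part `Y` and the cycle condition
  `Y₁₂Y₂₃Y₃₁ = Y₁₃Y₃₂Y₂₁` is completed to rank one by `w₁ = Y₁₂Y₃₁/Y₃₂, w₂ = Y₂₃Y₁₂/Y₁₃, w₃ = Y₃₁Y₂₃/Y₂₁`
  (stated division-free: the four `2 × 2` minors through the `(1,1)` entry vanish after clearing denominators);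
* `soloLie_gl3_adSq_rankOne` — `(ad y)² p = (vᵀu)(y p + p y) − 2 (vᵀ p u) y` for `y = u vᵀ` and any `p`, so
  `vᵀu = vᵀpu = 0` gives `(ad y)² p = 0` and `Ad(exp(s y)) p = p + s [y, p]` exactly.
-/

set_option linter.dupNamespace false

namespace Summit.MatrixMultiplication.MatrixMultiplication.Theorems

section Pencil

variable {R : Type*} [CommRing R]

/-- Determinant of the pencil `diag(p) + s e`, `e` off-diagonal:
`p₁p₂p₃ − s²(p₃π₁₂ + p₂π₁₃ + p₁π₂₃) + s³(γ + γ')`. -/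
theorem soloLie_gl3_det_pencil (p₁ p₂ p₃ s a₁₂ a₁₃ a₂₁ a₂₃ a₃₁ a₃₂ : R) :
    Matrix.det !![p₁, s * a₁₂, s * a₁₃; s * a₂₁, p₂, s * a₂₃; s * a₃₁, s * a₃₂, p₃]
      = p₁ * p₂ * p₃ - s ^ 2 * (p₃ * (a₁₂ * a₂₁) + p₂ * (a₁₃ * a₃₁) + p₁ * (a₂₃ * a₃₂))
        + s ^ 3 * (a₁₂ * a₂₃ * a₃₁ + a₁₃ * a₃₂ * a₂₁) := by
  rw [Matrix.det_fin_three]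
  simp
  ring

/-- Sum of the principal `2 × 2` minors of the pencil: `Σ p_ip_j − s² Σ π_ij`. -/
theorem soloLie_gl3_minors_pencil (p₁ p₂ p₃ s a₁₂ a₁₃ a₂₁ a₂₃ a₃₁ a₃₂ : R) :
    (p₁ * p₂ - (s * a₁₂) * (s * a₂₁)) + (p₁ * p₃ - (s * a₁₃) * (s * a₃₁)) + (p₂ * p₃ - (s * a₂₃) * (s * a₃₂))
      = (p₁ * p₂ + p₁ * p₃ + p₂ * p₃) - s ^ 2 * (a₁₂ * a₂₁ + a₁₃ * a₃₁ + a₂₃ * a₃₂) := by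
  ring

/-- The bracket of a rank-one matrix with a diagonal one: `[u vᵀ, diag p]_ij = u_i v_j (p_j − p_i)`. -/
theorem soloLie_gl3_rankOne_bracket (u₁ u₂ u₃ v₁ v₂ v₃ p₁ p₂ p₃ : R) :
    !![u₁ * v₁, u₁ * v₂, u₁ * v₃; u₂ * v₁, u₂ * v₂, u₂ * v₃; u₃ * v₁, u₃ * v₂, u₃ * v₃]
        * !![p₁, 0, 0; 0, p₂, 0; 0, 0, p₃]
      - !![p₁, 0, 0; 0, p₂, 0; 0, 0, p₃]
        * !![u₁ * v₁, u₁ * v₂, u₁ * v₃; u₂ * v₁, u₂ * v₂, u₂ * v₃; u₃ * v₁, u₃ * v₂, u₃ * v₃]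
      = !![0, u₁ * v₂ * (p₂ - p₁), u₁ * v₃ * (p₃ - p₁);
           u₂ * v₁ * (p₁ - p₂), 0, u₂ * v₃ * (p₃ - p₂);
           u₃ * v₁ * (p₁ - p₃), u₃ * v₂ * (p₂ - p₃), 0] := by
  ext i j
  fin_cases i <;> fin_cases j <;> simp <;> ring

/-- For `e = [u vᵀ, diag p]` (entries `e_ij = u_i v_j (p_j − p_i)`), with `w_i = u_i v_i`:
(3) `γ + γ' = 0` identically; `π_ij = −w_iw_j(p_i − p_j)²`; and the left side of (1),
`−(π₁₂ + π₁₃ + π₂₃) = Σ_{i<j} w_iw_j(p_i−p_j)²`, equals `A C − B²`. -/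
theorem soloLie_gl3_rankOne_conditions (u₁ u₂ u₃ v₁ v₂ v₃ p₁ p₂ p₃ : R) :
    ((u₁ * v₂ * (p₂ - p₁)) * (u₂ * v₃ * (p₃ - p₂)) * (u₃ * v₁ * (p₁ - p₃))
        + (u₁ * v₃ * (p₃ - p₁)) * (u₃ * v₂ * (p₂ - p₃)) * (u₂ * v₁ * (p₁ - p₂)) = 0) ∧
    ((u₁ * v₂ * (p₂ - p₁)) * (u₂ * v₁ * (p₁ - p₂)) = -((u₁ * v₁) * (u₂ * v₂)) * (p₁ - p₂) ^ 2) ∧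
    ((u₁ * v₁) * (u₂ * v₂) * (p₁ - p₂) ^ 2 + (u₁ * v₁) * (u₃ * v₃) * (p₁ - p₃) ^ 2
        + (u₂ * v₂) * (u₃ * v₃) * (p₂ - p₃) ^ 2
      = (u₁ * v₁ + u₂ * v₂ + u₃ * v₃) * (p₁ ^ 2 * (u₁ * v₁) + p₂ ^ 2 * (u₂ * v₂) + p₃ ^ 2 * (u₃ * v₃))
        - (p₁ * (u₁ * v₁) + p₂ * (u₂ * v₂) + p₃ * (u₃ * v₃)) ^ 2) := by
  refine ⟨by ring, by ring, by ring⟩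

/-- The distinguished diagonal `w* = (p₂−p₃, p₃−p₁, p₁−p₂)`: `A = Σ w*_i = 0`, `B = Σ p_i w*_i = 0`, and `w*`
solves (1) `Σ_{i<j} w_iw_j(p_i−p_j)² = 0` and (2) `Σ_{i<j} p_k w_iw_j(p_i−p_j)² = 0` (`k` the third index) as
polynomial identities in `p`. -/
theorem soloLie_gl3_wstar (p₁ p₂ p₃ : R) :
    ((p₂ - p₃) + (p₃ - p₁) + (p₁ - p₂) = 0) ∧
    (p₁ * (p₂ - p₃) + p₂ * (p₃ - p₁) + p₃ * (p₁ - p₂) = 0) ∧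
    ((p₂ - p₃) * (p₃ - p₁) * (p₁ - p₂) ^ 2 + (p₂ - p₃) * (p₁ - p₂) * (p₁ - p₃) ^ 2
        + (p₃ - p₁) * (p₁ - p₂) * (p₂ - p₃) ^ 2 = 0) ∧
    (p₃ * ((p₂ - p₃) * (p₃ - p₁) * (p₁ - p₂) ^ 2) + p₂ * ((p₂ - p₃) * (p₁ - p₂) * (p₁ - p₃) ^ 2)
        + p₁ * ((p₃ - p₁) * (p₁ - p₂) * (p₂ - p₃) ^ 2) = 0) := by
  refine ⟨by ring, by ring, by ring, by ring⟩

set_option maxHeartbeats 400000 in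
/-- `(ad y)² p = (vᵀu)(y p + p y) − 2 (vᵀ p u) y` for the rank-one `y = u vᵀ` and an arbitrary `3 × 3`
matrix `p`; in particular `vᵀu = 0 = vᵀ p u` gives `[y, [y, p]] = y²p − 2 y p y + p y² = 0`, so the one-parameter
orbit `Ad(exp(s y)) p = p + s [y, p]` is a straight line (the rank-one one-parameter planes of Lemma 18.4(B)). -/
theorem soloLie_gl3_adSq_rankOne (u₁ u₂ u₃ v₁ v₂ v₃ p₁₁ p₁₂ p₁₃ p₂₁ p₂₂ p₂₃ p₃₁ p₃₂ p₃₃ : R) :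
    !![u₁ * v₁, u₁ * v₂, u₁ * v₃; u₂ * v₁, u₂ * v₂, u₂ * v₃; u₃ * v₁, u₃ * v₂, u₃ * v₃]
        * !![u₁ * v₁, u₁ * v₂, u₁ * v₃; u₂ * v₁, u₂ * v₂, u₂ * v₃; u₃ * v₁, u₃ * v₂, u₃ * v₃]
        * !![p₁₁, p₁₂, p₁₃; p₂₁, p₂₂, p₂₃; p₃₁, p₃₂, p₃₃]
      - (2 : R) • (!![u₁ * v₁, u₁ * v₂, u₁ * v₃; u₂ * v₁, u₂ * v₂, u₂ * v₃; u₃ * v₁, u₃ * v₂, u₃ * v₃]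
        * !![p₁₁, p₁₂, p₁₃; p₂₁, p₂₂, p₂₃; p₃₁, p₃₂, p₃₃]
        * !![u₁ * v₁, u₁ * v₂, u₁ * v₃; u₂ * v₁, u₂ * v₂, u₂ * v₃; u₃ * v₁, u₃ * v₂, u₃ * v₃])
      + !![p₁₁, p₁₂, p₁₃; p₂₁, p₂₂, p₂₃; p₃₁, p₃₂, p₃₃]
        * !![u₁ * v₁, u₁ * v₂, u₁ * v₃; u₂ * v₁, u₂ * v₂, u₂ * v₃; u₃ * v₁, u₃ * v₂, u₃ * v₃]
        * !![u₁ * v₁, u₁ * v₂, u₁ * v₃; u₂ * v₁, u₂ * v₂, u₂ * v₃; u₃ * v₁, u₃ * v₂, u₃ * v₃]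
      = (u₁ * v₁ + u₂ * v₂ + u₃ * v₃) •
          (!![u₁ * v₁, u₁ * v₂, u₁ * v₃; u₂ * v₁, u₂ * v₂, u₂ * v₃; u₃ * v₁, u₃ * v₂, u₃ * v₃]
            * !![p₁₁, p₁₂, p₁₃; p₂₁, p₂₂, p₂₃; p₃₁, p₃₂, p₃₃]
          + !![p₁₁, p₁₂, p₁₃; p₂₁, p₂₂, p₂₃; p₃₁, p₃₂, p₃₃]
            * !![u₁ * v₁, u₁ * v₂, u₁ * v₃; u₂ * v₁, u₂ * v₂, u₂ * v₃; u₃ * v₁, u₃ * v₂, u₃ * v₃])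
        - (2 * (v₁ * (p₁₁ * u₁ + p₁₂ * u₂ + p₁₃ * u₃) + v₂ * (p₂₁ * u₁ + p₂₂ * u₂ + p₂₃ * u₃)
            + v₃ * (p₃₁ * u₁ + p₃₂ * u₂ + p₃₃ * u₃))) •
          !![u₁ * v₁, u₁ * v₂, u₁ * v₃; u₂ * v₁, u₂ * v₂, u₂ * v₃; u₃ * v₁, u₃ * v₂, u₃ * v₃] := by
  ext i j
  fin_cases i <;> fin_cases j <;> simp <;> ring

end Pencil

section Completion

variable {K : Type*} [Field K]

/-- RANK-ONE COMPLETION OF A `3 × 3` OFF-DIAGONAL ARRAY (division-free form).  If `w₁ y₃₂ = y₁₂ y₃₁`,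
`w₂ y₁₃ = y₂₃ y₁₂`, `w₃ y₂₁ = y₃₁ y₂₃` (the proposed diagonal) and the cycle condition
`y₁₂ y₂₃ y₃₁ = y₁₃ y₃₂ y₂₁` holds, then the four `2 × 2` minors of `M = (w on the diagonal, y off it)` through
the `(1,1)` entry vanish after multiplication by non-zero monomials; with all `y_ij ≠ 0` this says
`rank M = 1`, i.e. `M = u vᵀ` (Lemma 18.4(B): `[M, p₀] = e` for `y_ij = e_ij/(p_j − p_i)`). -/
theorem soloLie_rankOne_completion3 (y₁₂ y₁₃ y₂₁ y₂₃ y₃₁ y₃₂ w₁ w₂ w₃ : K)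
    (h1 : w₁ * y₃₂ = y₁₂ * y₃₁) (h2 : w₂ * y₁₃ = y₂₃ * y₁₂) (h3 : w₃ * y₂₁ = y₃₁ * y₂₃)
    (hc : y₁₂ * y₂₃ * y₃₁ = y₁₃ * y₃₂ * y₂₁) :
    ((w₁ * w₂) * (y₃₂ * y₁₃) = (y₂₁ * y₁₂) * (y₃₂ * y₁₃)) ∧
    (y₂₃ * w₁ * y₃₂ = y₂₁ * y₁₃ * y₃₂) ∧
    ((w₁ * w₃) * (y₃₂ * y₂₁) = (y₃₁ * y₁₃) * (y₃₂ * y₂₁)) ∧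
    ((w₂ * w₃) * (y₁₃ * y₂₁) = (y₂₃ * y₃₂) * (y₁₃ * y₂₁)) := by
  refine ⟨?_, ?_, ?_, ?_⟩
  · linear_combination (w₂ * y₁₃) * h1 + (y₁₂ * y₃₁) * h2 + y₁₂ * hc
  · linear_combination y₂₃ * h1 + hc
  · linear_combination (w₃ * y₂₁) * h1 + (y₁₂ * y₃₁) * h3 + y₃₁ * hc
  · linear_combination (w₃ * y₂₁) * h2 + (y₂₃ * y₁₂) * h3 + y₂₃ * hc

/-- The same with the non-vanishing hypotheses discharged: the genuine minors vanish. -/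
theorem soloLie_rankOne_completion3' (y₁₂ y₁₃ y₂₁ y₂₃ y₃₁ y₃₂ w₁ w₂ w₃ : K)
    (n13 : y₁₃ ≠ 0) (n21 : y₂₁ ≠ 0) (n32 : y₃₂ ≠ 0)
    (h1 : w₁ * y₃₂ = y₁₂ * y₃₁) (h2 : w₂ * y₁₃ = y₂₃ * y₁₂) (h3 : w₃ * y₂₁ = y₃₁ * y₂₃)
    (hc : y₁₂ * y₂₃ * y₃₁ = y₁₃ * y₃₂ * y₂₁) :
    (w₁ * w₂ = y₂₁ * y₁₂) ∧ (y₂₃ * w₁ = y₂₁ * y₁₃) ∧ (w₁ * w₃ = y₃₁ * y₁₃) ∧ (w₂ * w₃ = y₂₃ * y₃₂) := by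
  obtain ⟨e1, e2, e3, e4⟩ := soloLie_rankOne_completion3 y₁₂ y₁₃ y₂₁ y₂₃ y₃₁ y₃₂ w₁ w₂ w₃ h1 h2 h3 hc
  refine ⟨?_, ?_, ?_, ?_⟩
  · exact mul_right_cancel₀ (mul_ne_zero n32 n13) e1
  · have : y₂₃ * w₁ * y₃₂ = (y₂₁ * y₁₃) * y₃₂ := by rw [e2]
    exact mul_right_cancel₀ n32 this
  · exact mul_right_cancel₀ (mul_ne_zero n32 n21) e3
  · exact mul_right_cancel₀ (mul_ne_zero n13 n21) e4

end Completion

end Summit.MatrixMultiplication.MatrixMultiplication.Theorems
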